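import Summits.CriticalPhenomena.PercolationContinuityZ3.Theorems.Transplant.FKConnectivityAllQForestTwoSeparation
import HarnessLib

/-!
# The square-free adjacent forest node is an EQUALITY across a dense two-point separator

builds on p205010 (kernel theorem, internal audit signed; external expert review pending).  No definitions, no named facts, no sorries;
standard axioms.

The node `FK.AdjForestRayleighNoSqOn` (`…TwoClusterRayleighNoSq.lean`; vertex form: for a uniform pair `(A, B)` of edge-disjoint spanning
forests of `G'` with union `E(G')`, `P(e, f same colour) ≤ 1/2` for adjacent `e = ov`, `f = oy`) is an EQUALITY whenever a set `S ∋ o`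
separating `v` from `y` spans at least `2|S| - 3` pairs of the fibre ("dense separator"; memo bschramm/FROM-fk-1-g19-ADVERSARIAL.md §2f,
where the general statement is proved on paper by a gadget count).  g18 landed `|S| = 1` (`adjForestNoSq_fibre_eq_of_cutVertex`,
`…ForestAdjacentCutVertex.lean`).  THIS FILE lands `|S| = 2`: an interface `{o, w}` carrying the pair `g = ow` of the fibre.

Set-up: the pairs of `E₁` live on `V₁`, those of `E₂` on `V₂`, `V₁ ∩ V₂ ⊆ {o, w}`, `o ≠ w`, `E₁ ∩ E₂ = ∅`, `g = s(o,w) ∉ E₁ ∪ E₂`;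
the fibre `(M' = M ∪ {e, f}, u₀)` has all its pairs in `E₁ ∪ E₂ ∪ {g}` and CONTAINS `g` (`g ∈ M' ∪ u₀`); `e ∈ E₁`, `f ∈ E₂`.
* **`isForestCfg_iff_of_edgeSep`** (three-part forest factorisation): `X ∈ Fo ↔ X ∩ E₁ ∈ Fo ∧ X ∩ E₂ ∈ Fo ∧` at most one of
  `o ~ w in X ∩ E₁`, `g ∈ X`, `o ~ w in X ∩ E₂` (from g18's two-point factorisation `isForestCfg_union_iff_of_twoSep` and
  `isForestCfg_insert_iff`).
* **`adjForestNoSq_fibre_eq_of_edgeSep`**: `#(Fo ∩ {e, f ∈ ω}, Fo) = #(Fo ∩ {e ∈ ω}, Fo ∩ {f ∈ ω})` on such a fibre.  PROOF — the explicit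
  involution of the memo (§2f(v)) in its first non-trivial instance: with `σ = [o ~ w in ω ∩ E₂]`, `τ = [o ~ w in (ω ∆ M') ∩ E₂]`,
  `Φ ω = ω ∆ (M' ∩ E₂)` (recolour side 2 by its partner) if `σ ↔ τ`, and `Φ ω = ω ∆ ((M' ∩ E₂) ∪ (M' ∩ {g}))` (recolour side 2 AND the
  gadget pair) otherwise.  Since `g` is in one of the two colour classes, the factorisation leaves room for at most one of `α, β, σ, τ`
  (`α, β` the side-1 analogues), and a four-line case analysis shows `Φ` keeps both classes forests; `Φ` swaps `σ, τ`, so it respects the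
  case distinction and is an involution; it fixes the colour of `e` and flips that of `f`.
Examples covered: 2-sums along a present edge `ow`, the doubled pair `{o, w}` (one copy in `u₀`); NOT covered (and not equalities):
2-separations `{o, w}` without the pair `ow` (the wheel family `W(k;t)` of the memo has margin `2`).
[cite: Grimmett2006, §1.5 (p. 13); §3.8 (pp. 61–62)] [cite: SempleWelsh2008, Conj. 1.1 (p. 2)] [cite: Linusson2011, Prop. 2.6]
-/

noncomputable section

namespace Summit.CriticalPhenomena.PercolationContinuityZ3.Theorems

namespace FK

open Set Literature.Probability.LatticeModels Literature.Probability.Percolation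
open scoped Classical symmDiff

variable {V : Type*} [Fintype V]

section EdgeSep

variable {E₁ E₂ : Set (Sym2 V)} {V₁ V₂ : Set V} {o w : V}

omit [Fintype V] in
/-- In a configuration containing the pair `s(o,w)` (`o ≠ w`), `o ~ w`. [folklore] -/
theorem reachable_of_mem_pair {X : BondConfig V} (how : o ≠ w) (hg : s(o, w) ∈ X) : (openGraph X).Reachable o w :=
  SimpleGraph.Adj.reachable ((openGraph_adj X o w).2 ⟨hg, how⟩)

/-- **Three-part forest factorisation across the interface `{o, w}` carrying the pair `g = s(o,w)`**: for `X ⊆ E₁ ∪ E₂ ∪ {g}`,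
`X ∈ Fo ↔ X ∩ E₁ ∈ Fo ∧ X ∩ E₂ ∈ Fo ∧ ¬(o ~₁ w ∧ g ∈ X) ∧ ¬(o ~₂ w ∧ g ∈ X) ∧ ¬(o ~₁ w ∧ o ~₂ w)` (`~ᵢ` = joined in `X ∩ Eᵢ`):
the three `o–w` connections (side 1, the pair `g`, side 2) pairwise close cycles. [cite: Grimmett2006, §1.5 (p. 13); §3.8 (pp. 61–62)] -/
theorem isForestCfg_iff_of_edgeSep (h₁ : ∀ e ∈ E₁, ∀ z ∈ e, z ∈ V₁) (h₂ : ∀ e ∈ E₂, ∀ z ∈ e, z ∈ V₂) (hS : V₁ ∩ V₂ ⊆ {o, w})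
    (how : o ≠ w) (hd : Disjoint E₁ E₂) (hg₁ : s(o, w) ∉ E₁) (hg₂ : s(o, w) ∉ E₂) {X : BondConfig V}
    (hX : X ⊆ insert s(o, w) (E₁ ∪ E₂)) :
    IsForestCfg X ↔ IsForestCfg (X ∩ E₁) ∧ IsForestCfg (X ∩ E₂) ∧
      ¬ ((openGraph (X ∩ E₁)).Reachable o w ∧ s(o, w) ∈ X) ∧ ¬ ((openGraph (X ∩ E₂)).Reachable o w ∧ s(o, w) ∈ X) ∧
      ¬ ((openGraph (X ∩ E₁)).Reachable o w ∧ (openGraph (X ∩ E₂)).Reachable o w) := by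
  -- enlarge the vertex sides so that `g` lives on side 1
  have h₁' : ∀ e ∈ insert s(o, w) E₁, ∀ z ∈ e, z ∈ insert o (insert w V₁) := by
    intro e he z hz
    rcases mem_insert_iff.1 he with rfl | he
    · rcases Sym2.mem_iff.1 hz with rfl | rfl
      · exact mem_insert _ _
      · exact mem_insert_of_mem _ (mem_insert _ _)
    · exact mem_insert_of_mem _ (mem_insert_of_mem _ (h₁ e he z hz))
  have h₂' : ∀ e ∈ E₂, ∀ z ∈ e, z ∈ insert o (insert w V₂) := fun e he z hz =>
    mem_insert_of_mem _ (mem_insert_of_mem _ (h₂ e he z hz))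
  have hS' : insert o (insert w V₁) ∩ insert o (insert w V₂) ⊆ ({o, w} : Set V) := by
    rintro z ⟨hz1, hz2⟩
    rcases mem_insert_iff.1 hz1 with rfl | hz1
    · exact mem_insert _ _
    rcases mem_insert_iff.1 hz1 with rfl | hz1
    · exact mem_insert_of_mem _ (mem_singleton _)
    rcases mem_insert_iff.1 hz2 with rfl | hz2
    · exact mem_insert _ _
    rcases mem_insert_iff.1 hz2 with rfl | hz2
    · exact mem_insert_of_mem _ (mem_singleton _)
    exact hS ⟨hz1, hz2⟩
  have hd' : Disjoint (insert s(o, w) E₁) E₂ := by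
    rw [Set.disjoint_insert_left]; exact ⟨hg₂, hd⟩
  have hgX₁ : s(o, w) ∉ X ∩ E₁ := fun h => hg₁ h.2
  by_cases hgX : s(o, w) ∈ X
  · -- `X = (g ∪ X ∩ E₁) ∪ (X ∩ E₂)`
    have hsplit : X = insert s(o, w) (X ∩ E₁) ∪ (X ∩ E₂) := by
      ext x
      simp only [mem_union, mem_insert_iff, mem_inter_iff]
      constructor
      · intro hx
        rcases mem_insert_iff.1 (hX hx) with rfl | hx'
        · exact Or.inl (Or.inl rfl)
        · rcases hx' with hx' | hx'
          · exact Or.inl (Or.inr ⟨hx, hx'⟩)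
          · exact Or.inr ⟨hx, hx'⟩
      · rintro ((rfl | ⟨hx, -⟩) | ⟨hx, -⟩)
        · exact hgX
        · exact hx
        · exact hx
    have hreach : (openGraph (insert s(o, w) (X ∩ E₁))).Reachable o w := reachable_of_mem_pair how (mem_insert _ _)
    have key := isForestCfg_union_iff_of_twoSep h₁' h₂' hS' how hd' (ω₁ := insert s(o, w) (X ∩ E₁)) (ω₂ := X ∩ E₂)
      (insert_subset_insert inter_subset_right) inter_subset_right
    rw [isForestCfg_insert_iff how hgX₁] at key
    conv_lhs => rw [hsplit]
    rw [key]
    constructor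
    · rintro ⟨⟨hF1, hR1⟩, hF2, hboth⟩
      exact ⟨hF1, hF2, fun h => hR1 h.1, fun h => hboth ⟨hreach, h.1⟩, fun h => hR1 h.1⟩
    · rintro ⟨hF1, hF2, hn1, hn2, -⟩
      exact ⟨⟨hF1, fun h => hn1 ⟨h, hgX⟩⟩, hF2, fun h => hn2 ⟨h.2, hgX⟩⟩
  · have hX' : X ⊆ E₁ ∪ E₂ := fun x hx => by
      rcases mem_insert_iff.1 (hX hx) with rfl | hx'
      · exact absurd hx hgX
      · exact hx'
    have h₁'' : ∀ e ∈ E₁, ∀ z ∈ e, z ∈ insert o (insert w V₁) := fun e he z hz => h₁' e (mem_insert_of_mem _ he) z hz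
    rw [isForestCfg_iff_inter_of_twoSep h₁'' h₂' hS' how hd hX']
    constructor
    · rintro ⟨hF1, hF2, hboth⟩
      exact ⟨hF1, hF2, fun h => hgX h.2, fun h => hgX h.2, hboth⟩
    · rintro ⟨hF1, hF2, -, -, hboth⟩
      exact ⟨hF1, hF2, hboth⟩

end EdgeSep

/-! ### The involution and the equality -/

section Equality

variable {E₁ E₂ : Set (Sym2 V)} {V₁ V₂ : Set V} {M u₀ : BondConfig V} {o w v y : V}

omit [Fintype V] in
/-- Recolouring by `N` with `N ∩ E₁ = ∅` does not change side 1. [folklore] -/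
theorem symmDiff_inter_eq_of_disjoint {ω N E : BondConfig V} (hN : ∀ x ∈ N, x ∉ E) : (ω ∆ N) ∩ E = ω ∩ E := by
  ext x
  simp only [mem_inter_iff, Set.mem_symmDiff]
  constructor
  · rintro ⟨⟨hx, -⟩ | ⟨hxN, -⟩, hxE⟩
    · exact ⟨hx, hxE⟩
    · exact absurd hxE (hN x hxN)
  · rintro ⟨hx, hxE⟩
    exact ⟨Or.inl ⟨hx, fun h => hN x h hxE⟩, hxE⟩

omit [Fintype V] in
/-- Recolouring by `N` with `N ∩ E = M' ∩ E` turns side `E` into the partner's side `E`. [folklore] -/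
theorem symmDiff_inter_eq_partner {ω N M' E : BondConfig V} (hNM : N ⊆ M') (hMN : ∀ x ∈ M', x ∈ E → x ∈ N) :
    (ω ∆ N) ∩ E = (ω ∆ M') ∩ E := by
  ext x
  simp only [mem_inter_iff, Set.mem_symmDiff]
  constructor
  · rintro ⟨⟨hx, hxN⟩ | ⟨hxN, hx⟩, hxE⟩
    · exact ⟨Or.inl ⟨hx, fun h => hxN (hMN x h hxE)⟩, hxE⟩
    · exact ⟨Or.inr ⟨hNM hxN, hx⟩, hxE⟩
  · rintro ⟨⟨hx, hxM⟩ | ⟨hxM, hx⟩, hxE⟩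
    · exact ⟨Or.inl ⟨hx, fun h => hxM (hNM h)⟩, hxE⟩
    · exact ⟨Or.inr ⟨hMN x hxM hxE, hx⟩, hxE⟩

omit [Fintype V] in
/-- … and the partner's side `E` into side `E`. [folklore] -/
theorem symmDiff_symmDiff_inter_eq_self {ω N M' E : BondConfig V} (hNM : N ⊆ M') (hMN : ∀ x ∈ M', x ∈ E → x ∈ N) :
    ((ω ∆ N) ∆ M') ∩ E = ω ∩ E := by
  rw [symmDiff_symmDiff_eq_of_subset hNM]
  ext x
  simp only [mem_inter_iff, Set.mem_symmDiff, mem_sdiff]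
  constructor
  · rintro ⟨⟨hx, -⟩ | ⟨⟨hxM, hxN⟩, -⟩, hxE⟩
    · exact ⟨hx, hxE⟩
    · exact absurd (hMN x hxM hxE) hxN
  · rintro ⟨hx, hxE⟩
    exact ⟨Or.inl ⟨hx, fun h => h.2 (hMN x h.1 hxE)⟩, hxE⟩

omit [Fintype V] in
/-- … while the partner's side 1 is unchanged when `N ∩ E₁ = ∅`. [folklore] -/
theorem symmDiff_symmDiff_inter_eq_partner {ω N M' E : BondConfig V} (hNM : N ⊆ M') (hN : ∀ x ∈ N, x ∉ E) :
    ((ω ∆ N) ∆ M') ∩ E = (ω ∆ M') ∩ E := by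
  rw [symmDiff_symmDiff_eq_of_subset hNM]
  ext x
  simp only [mem_inter_iff, Set.mem_symmDiff, mem_sdiff]
  constructor
  · rintro ⟨⟨hx, hxMN⟩ | ⟨⟨hxM, -⟩, hx⟩, hxE⟩
    · exact ⟨Or.inl ⟨hx, fun h => hxMN ⟨h, fun h' => hN x h' hxE⟩⟩, hxE⟩
    · exact ⟨Or.inr ⟨hxM, hx⟩, hxE⟩
  · rintro ⟨⟨hx, hxM⟩ | ⟨hxM, hx⟩, hxE⟩
    · exact ⟨Or.inl ⟨hx, fun h => hxM h.1⟩, hxE⟩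
    · exact ⟨Or.inr ⟨⟨hxM, fun h => hN x h hxE⟩, hx⟩, hxE⟩

omit [Fintype V] in
/-- Membership of a pair outside `N` is unchanged by recolouring by `N`. [folklore] -/
theorem mem_symmDiff_iff_of_notMem {ω N : BondConfig V} {x : Sym2 V} (hx : x ∉ N) : x ∈ ω ∆ N ↔ x ∈ ω := by
  rw [Set.mem_symmDiff]
  exact ⟨fun h => h.elim (fun h => h.1) (fun h => absurd h.1 hx), fun h => Or.inl ⟨h, hx⟩⟩

omit [Fintype V] in
/-- Membership of a pair of `N` is flipped by recolouring by `N`. [folklore] -/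
theorem mem_symmDiff_iff_of_mem {ω N : BondConfig V} {x : Sym2 V} (hx : x ∈ N) : x ∈ ω ∆ N ↔ x ∉ ω := by
  rw [Set.mem_symmDiff]
  exact ⟨fun h => h.elim (fun h => absurd hx h.2) (fun h => h.2), fun h => Or.inr ⟨hx, h⟩⟩

/-- **The transfer step across a dense two-point separator** (memo §2f(v), `|S| = 2`).  On a fibre `(M', u₀)` with pairs in
`E₁ ∪ E₂ ∪ {g}`, `g = s(o,w) ∈ M' ∪ u₀`, let `N₀ = M' ∩ E₂`, `N₁ = N₀ ∪ (M' ∩ {g})`, and `Φ ω = ω ∆ N₁` if exactly one of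
`o ~ w in ω ∩ E₂`, `o ~ w in (ω ∆ M') ∩ E₂` holds, `Φ ω = ω ∆ N₀` otherwise.  Then `Φ` maps valid colourings (both `ω` and `ω ∆ M'`
forests) to valid colourings of the same fibre, is an involution, keeps side 1 and flips the free pairs of side 2.
[cite: Grimmett2006, §3.8 (pp. 61–62)] [cite: Linusson2011, Prop. 2.6] -/
theorem forest_pair_transfer_of_edgeSep (h₁ : ∀ e ∈ E₁, ∀ z ∈ e, z ∈ V₁) (h₂ : ∀ e ∈ E₂, ∀ z ∈ e, z ∈ V₂) (hS : V₁ ∩ V₂ ⊆ {o, w})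
    (how : o ≠ w) (hd : Disjoint E₁ E₂) (hg₁ : s(o, w) ∉ E₁) (hg₂ : s(o, w) ∉ E₂) {M' : BondConfig V}
    (hM' : M' ∪ u₀ ⊆ insert s(o, w) (E₁ ∪ E₂)) (hdense : s(o, w) ∈ M' ∪ u₀)
    (Φ : BondConfig V → BondConfig V)
    (hΦ : ∀ ω, Φ ω = if ¬ ((openGraph (ω ∩ E₂)).Reachable o w ↔ (openGraph ((ω ∆ M') ∩ E₂)).Reachable o w)
      then ω ∆ ((M' ∩ E₂) ∪ (M' ∩ {s(o, w)})) else ω ∆ (M' ∩ E₂))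
    {ω : BondConfig V} (hω : ω \ M' = u₀) (hF : IsForestCfg ω) (hFB : IsForestCfg (ω ∆ M')) :
    Φ ω \ M' = u₀ ∧ IsForestCfg (Φ ω) ∧ IsForestCfg ((Φ ω) ∆ M') ∧ Φ (Φ ω) = ω ∧
      (∀ x ∈ E₁, x ∈ Φ ω ↔ x ∈ ω) ∧ (∀ x ∈ M', x ∈ E₂ → (x ∈ Φ ω ↔ x ∉ ω)) := by
  set g : Sym2 V := s(o, w) with hg
  set N₀ : BondConfig V := M' ∩ E₂ with hN₀
  set N₁ : BondConfig V := (M' ∩ E₂) ∪ (M' ∩ {g}) with hN₁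
  -- where the configurations live
  have hωsub : ω ⊆ insert g (E₁ ∪ E₂) := fun x hx => by
    by_cases hxM : x ∈ M'
    · exact hM' (Or.inl hxM)
    · exact hM' (Or.inr (hω ▸ ⟨hx, hxM⟩))
  have hM'sub : M' ⊆ insert g (E₁ ∪ E₂) := fun x hx => hM' (Or.inl hx)
  have hsd : ∀ {X N : BondConfig V}, X ⊆ insert g (E₁ ∪ E₂) → N ⊆ M' → X ∆ N ⊆ insert g (E₁ ∪ E₂) := by
    intro X N hX hN x hx
    rw [Set.mem_symmDiff] at hx
    rcases hx with ⟨hx, -⟩ | ⟨hx, -⟩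
    · exact hX hx
    · exact hM'sub (hN hx)
  have hE : ∀ x, x ∈ E₁ → x ∉ E₂ := fun x hx1 hx2 => Set.disjoint_left.1 hd hx1 hx2
  -- the two recolouring sets
  have hN₀M : N₀ ⊆ M' := inter_subset_left
  have hN₁M : N₁ ⊆ M' := union_subset inter_subset_left inter_subset_left
  have hN₀E₁ : ∀ x ∈ N₀, x ∉ E₁ := fun x hx hx1 => hE x hx1 hx.2
  have hN₁E₁ : ∀ x ∈ N₁, x ∉ E₁ := by
    rintro x (hx | hx) hx1
    · exact hE x hx1 hx.2
    · rw [mem_inter_iff, mem_singleton_iff] at hx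
      exact hg₁ (hx.2 ▸ hx1)
  have hMN₀ : ∀ x ∈ M', x ∈ E₂ → x ∈ N₀ := fun x hx hx2 => ⟨hx, hx2⟩
  have hMN₁ : ∀ x ∈ M', x ∈ E₂ → x ∈ N₁ := fun x hx hx2 => Or.inl ⟨hx, hx2⟩
  have hgN₀ : g ∉ N₀ := fun h => hg₂ h.2
  -- profiles of `ω` and of its partner
  obtain ⟨hF1A, hF2A, hnA1, hnA2, hnA3⟩ := (isForestCfg_iff_of_edgeSep h₁ h₂ hS how hd hg₁ hg₂ hωsub).1 hF
  obtain ⟨hF1B, hF2B, hnB1, hnB2, hnB3⟩ :=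
    (isForestCfg_iff_of_edgeSep h₁ h₂ hS how hd hg₁ hg₂ (hsd hωsub subset_rfl)).1 hFB
  -- `g` is in one of the two classes
  have hab : g ∈ ω ∨ g ∈ ω ∆ M' := by
    rcases hdense with hgM | hgu
    · by_cases hgω : g ∈ ω
      · exact Or.inl hgω
      · exact Or.inr (Set.mem_symmDiff.2 (Or.inr ⟨hgM, hgω⟩))
    · exact Or.inl (hω ▸ hgu).1
  -- generic facts about recolouring by `N ∈ {N₀, N₁}`
  have hfacts : ∀ {N : BondConfig V}, N ⊆ M' → (∀ x ∈ N, x ∉ E₁) → (∀ x ∈ M', x ∈ E₂ → x ∈ N) →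
      (ω ∆ N) \ M' = u₀ ∧ (ω ∆ N) ∩ E₁ = ω ∩ E₁ ∧ (ω ∆ N) ∩ E₂ = (ω ∆ M') ∩ E₂ ∧
        ((ω ∆ N) ∆ M') ∩ E₁ = (ω ∆ M') ∩ E₁ ∧ ((ω ∆ N) ∆ M') ∩ E₂ = ω ∩ E₂ ∧
        (∀ x ∈ E₁, x ∈ ω ∆ N ↔ x ∈ ω) ∧ (∀ x ∈ M', x ∈ E₂ → (x ∈ ω ∆ N ↔ x ∉ ω)) := by
    intro N hNM hNE₁ hMN
    exact ⟨by rw [symmDiff_sdiff_eq_of_subset hNM, hω], symmDiff_inter_eq_of_disjoint hNE₁,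
      symmDiff_inter_eq_partner hNM hMN, symmDiff_symmDiff_inter_eq_partner hNM hNE₁,
      symmDiff_symmDiff_inter_eq_self hNM hMN, fun x hx => mem_symmDiff_iff_of_notMem (fun h => hNE₁ x h hx),
      fun x hxM hx2 => mem_symmDiff_iff_of_mem (hMN x hxM hx2)⟩
  by_cases hP : ¬ ((openGraph (ω ∩ E₂)).Reachable o w ↔ (openGraph ((ω ∆ M') ∩ E₂)).Reachable o w)
  · -- exactly one of `σ, τ`: recolour side 2 AND the gadget pair
    have hΦω : Φ ω = ω ∆ N₁ := by rw [hΦ ω, if_pos hP]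
    have hστ2 : ¬ (openGraph (ω ∩ E₂)).Reachable o w → (openGraph ((ω ∆ M') ∩ E₂)).Reachable o w := fun hσ =>
      by_contra fun hτ => hP ⟨fun h => absurd h hσ, fun h => absurd h hτ⟩
    obtain ⟨hfib, hT1, hT2, hT3, hT4, he, hf⟩ := hfacts hN₁M hN₁E₁ hMN₁
    -- `g ∈ M'` (otherwise `g` is in both classes and `σ = τ = false`)
    have hgM : g ∈ M' := by
      by_contra hgM
      have hgω : g ∈ ω := by
        rcases hdense with h | h
        · exact absurd h hgM
        · exact (hω ▸ h).1
      have hgB : g ∈ ω ∆ M' := Set.mem_symmDiff.2 (Or.inl ⟨hgω, hgM⟩)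
      exact hP ⟨fun h => absurd ⟨h, hgω⟩ hnA2, fun h => absurd ⟨h, hgB⟩ hnB2⟩
    have hgN₁ : g ∈ N₁ := Or.inr ⟨hgM, mem_singleton _⟩
    have hga : g ∈ ω ∆ N₁ ↔ g ∉ ω := mem_symmDiff_iff_of_mem hgN₁
    have hgb : g ∈ ω ∆ M' ↔ g ∉ ω := mem_symmDiff_iff_of_mem hgM
    have hgb' : g ∈ (ω ∆ N₁) ∆ M' ↔ g ∈ ω := by
      rw [mem_symmDiff_iff_of_mem hgM, hga]; exact not_not
    have hval : IsForestCfg (ω ∆ N₁) ∧ IsForestCfg ((ω ∆ N₁) ∆ M') := by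
      refine ⟨(isForestCfg_iff_of_edgeSep h₁ h₂ hS how hd hg₁ hg₂ (hsd hωsub hN₁M)).2 ?_,
        (isForestCfg_iff_of_edgeSep h₁ h₂ hS how hd hg₁ hg₂ (hsd (hsd hωsub hN₁M) subset_rfl)).2 ?_⟩
      · rw [hT1, hT2]
        refine ⟨hF1A, hF2B, ?_, ?_, ?_⟩
        · rintro ⟨hα, hgN⟩
          have hb : g ∈ ω ∆ M' := hgb.2 (hga.1 hgN)
          have hσ : (openGraph (ω ∩ E₂)).Reachable o w := by_contra fun hσ => hnB2 ⟨hστ2 hσ, hb⟩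
          exact hnA3 ⟨hα, hσ⟩
        · rintro ⟨hτ, hgN⟩
          exact hnB2 ⟨hτ, hgb.2 (hga.1 hgN)⟩
        · rintro ⟨hα, hτ⟩
          by_cases hga' : g ∈ ω
          · exact hnA1 ⟨hα, hga'⟩
          · exact hnB2 ⟨hτ, hgb.2 hga'⟩
      · rw [hT3, hT4]
        refine ⟨hF1B, hF2A, ?_, ?_, ?_⟩
        · rintro ⟨hβ, hg'⟩
          have hσ : ¬ (openGraph (ω ∩ E₂)).Reachable o w := fun hσ => hnA2 ⟨hσ, hgb'.1 hg'⟩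
          exact hnB3 ⟨hβ, hστ2 hσ⟩
        · rintro ⟨hσ, hg'⟩
          exact hnA2 ⟨hσ, hgb'.1 hg'⟩
        · rintro ⟨hβ, hσ⟩
          by_cases hga' : g ∈ ω
          · exact hnA2 ⟨hσ, hga'⟩
          · exact hnB1 ⟨hβ, hgb.2 hga'⟩
    have hP' : ¬ ((openGraph ((ω ∆ N₁) ∩ E₂)).Reachable o w ↔ (openGraph (((ω ∆ N₁) ∆ M') ∩ E₂)).Reachable o w) := by
      rw [hT2, hT4]; exact fun h => hP h.symm
    refine ⟨hΦω ▸ hfib, hΦω ▸ hval.1, hΦω ▸ hval.2, ?_, fun x hx => hΦω ▸ he x hx, fun x hxM hx2 => hΦω ▸ hf x hxM hx2⟩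
    rw [hΦω, hΦ (ω ∆ N₁), if_pos hP']
    exact symmDiff_symmDiff_cancel_right _ _
  · -- `σ ↔ τ`: recolour side 2 only
    have hΦω : Φ ω = ω ∆ N₀ := by rw [hΦ ω, if_neg hP]
    obtain ⟨hfib, hT1, hT2, hT3, hT4, he, hf⟩ := hfacts hN₀M hN₀E₁ hMN₀
    have hst : (openGraph (ω ∩ E₂)).Reachable o w ↔ (openGraph ((ω ∆ M') ∩ E₂)).Reachable o w := not_not.1 hP
    have hga : g ∈ ω ∆ N₀ ↔ g ∈ ω := mem_symmDiff_iff_of_notMem hgN₀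
    have hgb' : g ∈ (ω ∆ N₀) ∆ M' ↔ g ∈ ω ∆ M' := by
      rw [Set.mem_symmDiff, hga, Set.mem_symmDiff]
    have hval : IsForestCfg (ω ∆ N₀) ∧ IsForestCfg ((ω ∆ N₀) ∆ M') := by
      refine ⟨(isForestCfg_iff_of_edgeSep h₁ h₂ hS how hd hg₁ hg₂ (hsd hωsub hN₀M)).2 ?_,
        (isForestCfg_iff_of_edgeSep h₁ h₂ hS how hd hg₁ hg₂ (hsd (hsd hωsub hN₀M) subset_rfl)).2 ?_⟩
      · rw [hT1, hT2]
        refine ⟨hF1A, hF2B, ?_, ?_, ?_⟩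
        · rintro ⟨hα, hg'⟩; exact hnA1 ⟨hα, hga.1 hg'⟩
        · rintro ⟨hτ, hg'⟩; exact hnA2 ⟨hst.2 hτ, hga.1 hg'⟩
        · rintro ⟨hα, hτ⟩; exact hnA3 ⟨hα, hst.2 hτ⟩
      · rw [hT3, hT4]
        refine ⟨hF1B, hF2A, ?_, ?_, ?_⟩
        · rintro ⟨hβ, hg'⟩; exact hnB1 ⟨hβ, hgb'.1 hg'⟩
        · rintro ⟨hσ, hg'⟩; exact hnB2 ⟨hst.1 hσ, hgb'.1 hg'⟩
        · rintro ⟨hβ, hσ⟩; exact hnB3 ⟨hβ, hst.1 hσ⟩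
    have hP' : ¬ ¬ ((openGraph ((ω ∆ N₀) ∩ E₂)).Reachable o w ↔ (openGraph (((ω ∆ N₀) ∆ M') ∩ E₂)).Reachable o w) := by
      rw [hT2, hT4, not_not]; exact hst.symm
    refine ⟨hΦω ▸ hfib, hΦω ▸ hval.1, hΦω ▸ hval.2, ?_, fun x hx => hΦω ▸ he x hx, fun x hxM hx2 => hΦω ▸ hf x hxM hx2⟩
    rw [hΦω, hΦ (ω ∆ N₀), if_neg hP']
    exact symmDiff_symmDiff_cancel_right _ _

/-- **The node's inequality is an EQUALITY across a dense two-point separator.**  Fibre `(M ∪ {e, f}, u₀)`, `e = ov ∈ E₁`,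
`f = oy ∈ E₂`, the pairs of `Eᵢ` on `Vᵢ`, `V₁ ∩ V₂ ⊆ {o, w}` (`o ≠ w`), `E₁ ∩ E₂ = ∅`, `g = ow ∉ E₁ ∪ E₂`, all pairs of the fibre in
`E₁ ∪ E₂ ∪ {g}` and `g` AMONG them (`g ∈ M ∪ {e, f} ∪ u₀` — the density `|E(S)| ≥ 2|S| - 3` for `S = {o, w}`):
`#(Fo ∩ {e, f ∈ ω}, Fo) = #(Fo ∩ {e ∈ ω}, Fo ∩ {f ∈ ω})`, i.e. `P(e, f same colour) = 1/2` exactly.  The case `|S| = 2` of the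
dense-separator equality (memo bschramm/FROM-fk-1-g19-ADVERSARIAL.md §2f); `|S| = 1` is `adjForestNoSq_fibre_eq_of_cutVertex`.
[cite: SempleWelsh2008, Conj. 1.1 (p. 2)] [cite: Linusson2011, Prop. 2.6] [cite: Grimmett2006, §3.8 (pp. 61–62)] -/
theorem adjForestNoSq_fibre_eq_of_edgeSep (h₁ : ∀ e ∈ E₁, ∀ z ∈ e, z ∈ V₁) (h₂ : ∀ e ∈ E₂, ∀ z ∈ e, z ∈ V₂) (hS : V₁ ∩ V₂ ⊆ {o, w})
    (how : o ≠ w) (hd : Disjoint E₁ E₂) (hg₁ : s(o, w) ∉ E₁) (hg₂ : s(o, w) ∉ E₂) (heE : s(o, v) ∈ E₁) (hfE : s(o, y) ∈ E₂)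
    (hsub : insert s(o, y) (insert s(o, v) M) ∪ u₀ ⊆ insert s(o, w) (E₁ ∪ E₂))
    (hdense : s(o, w) ∈ insert s(o, y) (insert s(o, v) M) ∪ u₀) :
    fibreCount (insert s(o, y) (insert s(o, v) M)) u₀ (forestEv V ∩ {ω | s(o, v) ∈ ω ∧ s(o, y) ∈ ω}) (forestEv V) =
      fibreCount (insert s(o, y) (insert s(o, v) M)) u₀ (forestEv V ∩ {ω | s(o, v) ∈ ω}) (forestEv V ∩ {ω | s(o, y) ∈ ω}) := by
  set M' : BondConfig V := insert s(o, y) (insert s(o, v) M) with hM'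
  set Φ : BondConfig V → BondConfig V := fun ω =>
    if ¬ ((openGraph (ω ∩ E₂)).Reachable o w ↔ (openGraph ((ω ∆ M') ∩ E₂)).Reachable o w)
      then ω ∆ ((M' ∩ E₂) ∪ (M' ∩ {s(o, w)})) else ω ∆ (M' ∩ E₂) with hΦdef
  have hΦ : ∀ ω, Φ ω = if ¬ ((openGraph (ω ∩ E₂)).Reachable o w ↔ (openGraph ((ω ∆ M') ∩ E₂)).Reachable o w)
      then ω ∆ ((M' ∩ E₂) ∪ (M' ∩ {s(o, w)})) else ω ∆ (M' ∩ E₂) := fun ω => rfl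
  have hfM : s(o, y) ∈ M' := mem_insert _ _
  have hfB : ∀ X : BondConfig V, s(o, y) ∈ X ∆ M' ↔ s(o, y) ∉ X := fun X => mem_symmDiff_iff_of_mem hfM
  refine fibreCount_eq_of_bij Φ Φ (fun ω hω hA hB => ?_) (fun ω hω hA hB => ?_)
  · -- bad ↦ good
    obtain ⟨hF, he, hf⟩ := hA
    have hF' : IsForestCfg ω := hF
    have hFB : IsForestCfg (ω ∆ M') := hB
    obtain ⟨hfib, hF1, hF2, hinv, hE1, hE2⟩ :=
      forest_pair_transfer_of_edgeSep h₁ h₂ hS how hd hg₁ hg₂ hsub hdense Φ hΦ hω hF' hFB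
    refine ⟨hfib, ⟨hF1, (hE1 _ heE).2 he⟩, ⟨hF2, ?_⟩, hinv⟩
    show s(o, y) ∈ (Φ ω) ∆ M'
    rw [hfB, hE2 _ hfM hfE, not_not]; exact hf
  · -- good ↦ bad
    obtain ⟨hF, he⟩ := hA
    obtain ⟨hFB, hf⟩ := hB
    have hF' : IsForestCfg ω := hF
    have hFB' : IsForestCfg (ω ∆ M') := hFB
    obtain ⟨hfib, hF1, hF2, hinv, hE1, hE2⟩ :=
      forest_pair_transfer_of_edgeSep h₁ h₂ hS how hd hg₁ hg₂ hsub hdense Φ hΦ hω hF' hFB'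
    have hfω : s(o, y) ∉ ω := (hfB ω).1 hf
    exact ⟨hfib, ⟨hF1, (hE1 _ heE).2 he, (hE2 _ hfM hfE).2 hfω⟩, hF2, hinv⟩

end Equality

end FK

end Summit.CriticalPhenomena.PercolationContinuityZ3.Theorems

end
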